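import Summits.MatrixMultiplication.OmegaCensus.SmallFormats.MatMul22nRankGF7Slack5Search
import HarnessLib

/-!
# ω-census family (a): replay of the slack-5 search certificate, CHECK B part 6 of 8 (classes `354 ≤ c < 486`)

Cell `pub-omega` (unit `pub-omega-tensor-g16`), topic `Summits/MatrixMultiplication/OmegaCensus` (sub-folder `SmallFormats`).
Framing (verbatim): lottery ticket; floor = certified bounds/negative ranges. HONEST FRAMING: machine-generated kernel replay
(`pub-omega-tensor-g16/code/gen5_runs.py`): `search5 c = true` for the classes `354 ≤ c < 486` (4438 search nodes in 3 `decide`s).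
Meaning (`search5_sound`, `MatMul22nRankGF7Slack5SearchSound`): no LP-tight point of slack 5 has one of these representatives as torus-0 column.
Nothing here is progress on `ω`.
-/

namespace Summit.MatrixMultiplication.OmegaCensus.SmallFormats

set_option Elab.async false

set_option maxRecDepth 100000 in
set_option maxHeartbeats 400000000 in
/-- Classes `354 ≤ c < 396` (1495 nodes). -/
theorem search5_ok_354_396 : ∀ c : Fin 656, 354 ≤ c.val → c.val < 396 → search5 c.val = true := by decide +kernel

set_option maxRecDepth 100000 in
set_option maxHeartbeats 400000000 in
/-- Classes `396 ≤ c < 444` (1455 nodes). -/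
theorem search5_ok_396_444 : ∀ c : Fin 656, 396 ≤ c.val → c.val < 444 → search5 c.val = true := by decide +kernel

set_option maxRecDepth 100000 in
set_option maxHeartbeats 400000000 in
/-- Classes `444 ≤ c < 486` (1488 nodes). -/
theorem search5_ok_444_486 : ∀ c : Fin 656, 444 ≤ c.val → c.val < 486 → search5 c.val = true := by decide +kernel

/-- CHECK B for the classes `354 ≤ c < 486`. -/
theorem search5_run_6 : ∀ c : Fin 656, 354 ≤ c.val → c.val < 486 → search5 c.val = true := by
  intro c hlo hhi
  by_cases h396 : c.val < 396
  · exact search5_ok_354_396 c (by omega) h396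
  by_cases h444 : c.val < 444
  · exact search5_ok_396_444 c (by omega) h444
  exact search5_ok_444_486 c (by omega) hhi

end Summit.MatrixMultiplication.OmegaCensus.SmallFormats
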